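import Literature.Probability.Percolation.PercolationProofs
import Summits.CriticalPhenomena.PercolationContinuityZ3.Theorems.AdditiveGluing.Negative.CertWeighted

/-!
# `NoHeavyLowerTail` (crux stmt-CriticalPhenomena-4575 ≡ KN Conjecture 3), certificate programme:
# the UNIFORM-DENSITY counting normal form ("level counts") and level-wise dominance

The crux and its finitely-checkable linear proxies (`AdditiveGluing` = stmt-4576, the linear lower-tail
forms of Disproof §D.1, Kozma–Nitzan's Conjecture 1) are statements about `prodBernoulli w` for arbitrary
weights.  The kernel-checked certificates in the tree (`Theorems/AdditiveGluing/Negative/Cert*.lean`,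
`Theorems/NoHeavyLowerTail/Negative/HalfWeightFin4Certificates.lean`) all sit at ONE density, `1/2`,
where probabilities are integer counts over `2^{|E|}`.  The crux, however, lives near density ONE.
This file is the bridge that lets a single integer computation certify an inequality for EVERY uniform
density `p ∈ [0, 1]` at once:

* `uniformOn_real_eq_sum_powerset` — under the weights `p · 𝟙_E` (density `p` on the finite set `E` of
  coordinates, `0` elsewhere; for a simple graph `G` this is `bondPercolation G p`,
  `bondPercolation_eq_prodBernoulli_uniformOn`) the probability of ANY event `D` is
  `Σ_{S ⊆ E, S ∈ D} p^{|S|} (1 − p)^{|E| − |S|}`;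
* `uniformOn_real_eq_levelSum` — grouped by LEVEL `k = |S|`:
  `P_p(D) = Σ_{k=0}^{|E|} #_k(D) · p^k (1 − p)^{|E| − k}`, `#_k(D) = #{S ⊆ E : |S| = k, S ∈ D}`
  (the Bernstein form of the polynomial `p ↦ P_p(D)`);
* `uniformOn_real_mono_of_levelCount_le`, `uniformOn_real_le_add_of_levelCount_le` — LEVEL-WISE
  DOMINANCE: `#_k(D₁) ≤ #_k(D₂)` (resp. `≤ #_k(D₂) + #_k(D₃)`) for all `k` gives `P_p(D₁) ≤ P_p(D₂)`
  (resp. `≤ P_p(D₂) + P_p(D₃)`) for every `p ∈ [0,1]` — the certificate shape that the exact sweeps of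
  the compute-cert seat (kit jobs j018493/j018506: "AG and HUB never needed subdivision; one relay works at
  all p with level-wise counting dominance") found to hold on every instance with `n ≤ 7`.

Nothing here asserts or refutes the crux; these are counting identities for product measures.
-/

namespace Summit.CriticalPhenomena.PercolationContinuityZ3.Theorems

open MeasureTheory
open Literature.Probability.LatticeModels Literature.Probability.Percolation
open Summit.CriticalPhenomena.PercolationContinuityZ3.Theorems.AdditiveGluing.Negative.Cert

/-- The product of the cylinder weights at a uniform density: for `S ⊆ E`,
`∏_{i ∈ E} (p if i ∈ S else 1 − p) = p^{|S|} (1 − p)^{|E| − |S|}`. [folklore] -/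
theorem prod_ite_mem_eq_pow {ι : Type} [DecidableEq ι] (E S : Finset ι) (hS : S ⊆ E) (x y : ℝ) :
    (∏ i ∈ E, (if i ∈ S then x else y)) = x ^ S.card * y ^ (E.card - S.card) := by
  rw [Finset.prod_ite, Finset.prod_const, Finset.prod_const, Finset.filter_mem_eq_inter,
    Finset.inter_eq_right.2 hS, Finset.filter_not, Finset.filter_mem_eq_inter,
    Finset.inter_eq_right.2 hS, Finset.card_sdiff_of_subset hS]

open Classical in
/-- **Counting normal form at a uniform density, powerset form.** Under the weights `p · 𝟙_E` the
probability of any event `D` is `Σ_{S ⊆ E, S ∈ D} p^{|S|} (1 − p)^{|E| − |S|}`. [folklore] -/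
theorem uniformOn_real_eq_sum_powerset {ι : Type} [Fintype ι] [DecidableEq ι] (E : Finset ι)
    (p : unitInterval) (D : Set (Set ι)) :
    (prodBernoulli (fun i => if i ∈ E then p else 0)).real D =
      ∑ S ∈ E.powerset, if (↑S : Set ι) ∈ D then
        (p : ℝ) ^ S.card * (1 - (p : ℝ)) ^ (E.card - S.card) else 0 := by
  have hp : ∀ i ∉ E, (fun i => if i ∈ E then p else 0 : ι → unitInterval) i = 0 := fun i hi => by
    simp only [if_neg hi]
  rw [prodBernoulli_real_eq_sum_powerset_of_support _ E hp D]
  refine Finset.sum_congr rfl fun S hS => ?_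
  rw [Finset.mem_powerset] at hS
  have hprod : (∏ i ∈ E, (if i ∈ S then
      (((fun i => if i ∈ E then p else 0 : ι → unitInterval) i : unitInterval) : ℝ)
      else 1 - (((fun i => if i ∈ E then p else 0 : ι → unitInterval) i : unitInterval) : ℝ))) =
      (p : ℝ) ^ S.card * (1 - (p : ℝ)) ^ (E.card - S.card) := by
    rw [← prod_ite_mem_eq_pow E S hS]
    exact Finset.prod_congr rfl fun i hi => by simp only [if_pos hi]
  by_cases hD : (↑S : Set ι) ∈ D
  · rw [if_pos hD, if_pos hD]
    exact hprod
  · rw [if_neg hD, if_neg hD]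

open Classical in
/-- **Counting normal form at a uniform density, LEVEL form** (Bernstein form of `p ↦ P_p(D)`):
`P_p(D) = Σ_{k = 0}^{|E|} #{S ⊆ E : |S| = k, S ∈ D} · p^k (1 − p)^{|E| − k}`. [folklore] -/
theorem uniformOn_real_eq_levelSum : ∀ {ι : Type} [Fintype ι] [DecidableEq ι] (E : Finset ι) (p : unitInterval) (D : Set (Set ι)), (Literature.Probability.LatticeModels.prodBernoulli (fun i => if i ∈ E then p else 0)).real D = ∑ k ∈ Finset.range (E.card + 1), (((E.powerset.filter fun S : Finset ι => S.card = k ∧ (↑S : Set ι) ∈ D).card : ℕ) : ℝ) * (p : ℝ) ^ k * (1 - (p : ℝ)) ^ (E.card - k) := by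
  intro ι _ _ E p D
  rw [uniformOn_real_eq_sum_powerset,
    ← Finset.sum_fiberwise_of_maps_to (s := E.powerset) (t := Finset.range (E.card + 1))
      (g := Finset.card) (fun S hS => Finset.mem_range.2
        (Nat.lt_succ_of_le (Finset.card_le_card (Finset.mem_powerset.1 hS))))]
  refine Finset.sum_congr rfl fun k _ => ?_
  rw [Finset.sum_ite, Finset.sum_const_zero, add_zero, Finset.filter_filter]
  have h1 : (∑ S ∈ E.powerset.filter (fun S : Finset ι => S.card = k ∧ (↑S : Set ι) ∈ D),
      (p : ℝ) ^ S.card * (1 - (p : ℝ)) ^ (E.card - S.card)) =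
      ∑ S ∈ E.powerset.filter (fun S : Finset ι => S.card = k ∧ (↑S : Set ι) ∈ D),
        (p : ℝ) ^ k * (1 - (p : ℝ)) ^ (E.card - k) := by
    refine Finset.sum_congr rfl fun S hS => ?_
    rw [Finset.mem_filter] at hS
    rw [hS.2.1]
  rw [h1, Finset.sum_const, nsmul_eq_mul, mul_assoc]

open Classical in
/-- **Level-wise dominance ⟹ dominance at every density.** If `#_k(D₁) ≤ #_k(D₂)` for every level
`k`, then `P_p(D₁) ≤ P_p(D₂)` under the weights `p · 𝟙_E`, for every `p ∈ [0,1]`. [folklore] -/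
theorem uniformOn_real_mono_of_levelCount_le : ∀ {ι : Type} [Fintype ι] [DecidableEq ι] (E : Finset ι) (p : unitInterval) (D₁ D₂ : Set (Set ι)), (∀ k : ℕ, (E.powerset.filter fun S : Finset ι => S.card = k ∧ (↑S : Set ι) ∈ D₁).card ≤ (E.powerset.filter fun S : Finset ι => S.card = k ∧ (↑S : Set ι) ∈ D₂).card) → (Literature.Probability.LatticeModels.prodBernoulli (fun i => if i ∈ E then p else 0)).real D₁ ≤ (Literature.Probability.LatticeModels.prodBernoulli (fun i => if i ∈ E then p else 0)).real D₂ := by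
  intro ι _ _ E p D₁ D₂ h
  rw [uniformOn_real_eq_levelSum E p D₁, uniformOn_real_eq_levelSum E p D₂]
  refine Finset.sum_le_sum fun k _ => ?_
  have hp0 : 0 ≤ (p : ℝ) := p.2.1
  have hp1 : 0 ≤ 1 - (p : ℝ) := sub_nonneg.2 p.2.2
  have hw : 0 ≤ (p : ℝ) ^ k * (1 - (p : ℝ)) ^ (E.card - k) := mul_nonneg (pow_nonneg hp0 _) (pow_nonneg hp1 _)
  have hc : (((E.powerset.filter fun S : Finset ι => S.card = k ∧ (↑S : Set ι) ∈ D₁).card : ℕ) : ℝ) ≤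
      (((E.powerset.filter fun S : Finset ι => S.card = k ∧ (↑S : Set ι) ∈ D₂).card : ℕ) : ℝ) := by
    exact_mod_cast h k
  calc _ = (((E.powerset.filter fun S : Finset ι => S.card = k ∧ (↑S : Set ι) ∈ D₁).card : ℕ) : ℝ) *
        ((p : ℝ) ^ k * (1 - (p : ℝ)) ^ (E.card - k)) := by ring
    _ ≤ (((E.powerset.filter fun S : Finset ι => S.card = k ∧ (↑S : Set ι) ∈ D₂).card : ℕ) : ℝ) *
        ((p : ℝ) ^ k * (1 - (p : ℝ)) ^ (E.card - k)) := mul_le_mul_of_nonneg_right hc hw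
    _ = _ := by ring

open Classical in
/-- **Level-wise dominance by a sum ⟹ dominance at every density.** If
`#_k(D₁) ≤ #_k(D₂) + #_k(D₃)` for every level `k`, then `P_p(D₁) ≤ P_p(D₂) + P_p(D₃)` under the weights
`p · 𝟙_E`, for every `p ∈ [0,1]` (the shape of the linear lower-tail certificates). [folklore] -/
theorem uniformOn_real_le_add_of_levelCount_le : ∀ {ι : Type} [Fintype ι] [DecidableEq ι] (E : Finset ι) (p : unitInterval) (D₁ D₂ D₃ : Set (Set ι)), (∀ k : ℕ, (E.powerset.filter fun S : Finset ι => S.card = k ∧ (↑S : Set ι) ∈ D₁).card ≤ (E.powerset.filter fun S : Finset ι => S.card = k ∧ (↑S : Set ι) ∈ D₂).card + (E.powerset.filter fun S : Finset ι => S.card = k ∧ (↑S : Set ι) ∈ D₃).card) → (Literature.Probability.LatticeModels.prodBernoulli (fun i => if i ∈ E then p else 0)).real D₁ ≤ (Literature.Probability.LatticeModels.prodBernoulli (fun i => if i ∈ E then p else 0)).real D₂ + (Literature.Probability.LatticeModels.prodBernoulli (fun i => if i ∈ E then p else 0)).real D₃ := by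
  intro ι _ _ E p D₁ D₂ D₃ h
  rw [uniformOn_real_eq_levelSum E p D₁, uniformOn_real_eq_levelSum E p D₂,
    uniformOn_real_eq_levelSum E p D₃, ← Finset.sum_add_distrib]
  refine Finset.sum_le_sum fun k _ => ?_
  have hp0 : 0 ≤ (p : ℝ) := p.2.1
  have hp1 : 0 ≤ 1 - (p : ℝ) := sub_nonneg.2 p.2.2
  have hw : 0 ≤ (p : ℝ) ^ k * (1 - (p : ℝ)) ^ (E.card - k) := mul_nonneg (pow_nonneg hp0 _) (pow_nonneg hp1 _)
  have hc : (((E.powerset.filter fun S : Finset ι => S.card = k ∧ (↑S : Set ι) ∈ D₁).card : ℕ) : ℝ) ≤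
      (((E.powerset.filter fun S : Finset ι => S.card = k ∧ (↑S : Set ι) ∈ D₂).card : ℕ) : ℝ) +
      (((E.powerset.filter fun S : Finset ι => S.card = k ∧ (↑S : Set ι) ∈ D₃).card : ℕ) : ℝ) := by
    exact_mod_cast h k
  calc _ = (((E.powerset.filter fun S : Finset ι => S.card = k ∧ (↑S : Set ι) ∈ D₁).card : ℕ) : ℝ) *
        ((p : ℝ) ^ k * (1 - (p : ℝ)) ^ (E.card - k)) := by ring
    _ ≤ ((((E.powerset.filter fun S : Finset ι => S.card = k ∧ (↑S : Set ι) ∈ D₂).card : ℕ) : ℝ) +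
        (((E.powerset.filter fun S : Finset ι => S.card = k ∧ (↑S : Set ι) ∈ D₃).card : ℕ) : ℝ)) *
        ((p : ℝ) ^ k * (1 - (p : ℝ)) ^ (E.card - k)) := mul_le_mul_of_nonneg_right hc hw
    _ = _ := by ring

open Classical in
/-- `P_p` on a simple graph `G` is the product Bernoulli measure with the weights `p · 𝟙_{E(G)}`,
written with the edge FINSET `Eset (edgeList G)` of the certified checkers
(`bondPercolation_eq_prodBernoulli_wHalf` is the case `p = 1/2`). [folklore] -/
theorem bondPercolation_eq_prodBernoulli_uniformOn {n : ℕ} (G : SimpleGraph (Fin n)) (p : unitInterval) :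
    bondPercolation G p = prodBernoulli (fun e => if e ∈ Eset (edgeList G) then p else 0) := by
  rw [bondPercolation, ← prodBernoulli_indicator_holds G.edgeSet p]
  have hE : ∀ e, e ∈ Eset (edgeList G) ↔ e ∈ G.edgeSet := fun e => by
    rw [← Finset.mem_coe, coe_Eset_edgeList]
  congr 1
  funext e
  simp only [hE]

end Summit.CriticalPhenomena.PercolationContinuityZ3.Theorems
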